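import Summits.KontsevichZagierPeriods.KontsevichZagierPeriods.Theorems.SoloInformedAlgSplitZ
import Literature.NumberTheory.Transcendental.SemialgebraicAlgebraicPoints
import HarnessLib

/-!
# The DEN-calculus over `K`: THEOREM FIN — denominators with finitely many zeros on the open square

Solo programme `solo-KontsevichZagierPeriods-informed`, session s108, step 2 of THEOREM 2D⁺.

**THEOREM FIN** (`soloInformed_presentableDenK_of_finite_zeros`).  Over a real-root-closed field
`K ⊆ ℝ` of real algebraic numbers, every `Q ∈ K[x₀, x₁]` whose zero set in the OPEN square
`(0,1)²` is finite is a presentable denominator.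

Proof: induction on the number of zeros in the open square.  With no zero, this is THEOREM 2D
(`soloInformed_presentableDenK_dim2`).  Otherwise pick a zero `z`; its abscissa `z₀ ∈ (0,1)` is a
real algebraic number (the zero set is a finite `ℚ`-semialgebraic set, whose points have algebraic
coordinates — `isAlgebraic_of_mem_of_finite` applied to a coordinate projection), hence `z₀ ∈ K`
(real-root-closedness, `soloInformed_exists_algebraMap_eq_of_isAlgebraic`).  Cut the square at
`x₀ = z₀` (RULE SPLIT₀, `soloInformed_presentableDenK_of_split₀`, which allows zeros of `Q`): the
zeros of the two rescaled halves in their open squares come injectively from the zeros of `Q` off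
the cut line, so each half has fewer zeros (`soloInformed_zeroSet_scaleSubstK`), and the
induction hypothesis applies.

References: Kontsevich–Zagier 2001 §1.2; Bochnak–Coste–Roy 1998, Prop. 2.2.6; Basu–Pollack–Roy
2006, Thm. 2.76 (images of semialgebraic sets).
-/

noncomputable section

open scoped BigOperators
open MeasureTheory Set
open Literature.NumberTheory.Transcendental Literature.NumberTheory.Transcendental.KZ
open Literature.ModelTheory.ExponentialFields (IsSemialgebraic)

namespace Summit.KontsevichZagierPeriods.KontsevichZagierPeriods.Theorems

variable {K : Type*} [Field K] [Algebra K ℝ] {n : ℕ}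

/-! ## Zero sets in the open cube: semialgebraicity, algebraic coordinates -/

/-- The zero set of `Q ∈ K[x]` in the open cube is `ℚ`-semialgebraic (an equaliser of two
`ℚ`-semialgebraic functions, LEMMA ALG-COEFF). [cite: BochnakCosteRoy1998, Prop. 2.2.6] -/
theorem soloInformed_isSemialgebraic_zeroSetK (hK : ∀ c : K, IsAlgebraic ℚ (algebraMap K ℝ c))
    (Q : MvPolynomial (Fin n) K) :
    IsSemialgebraic ℚ
      {x | x ∈ soloInformedOpenCube n ∧ (MvPolynomial.aeval x Q : ℝ) = 0} := by
  have h := isSemialgebraic_sep_eq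
    (soloInformed_isSemialgebraicFunOn_aevalK hK (isSemialgebraic_soloInformedOpenCube n) Q)
    (isSemialgebraicFunOn_natCast (isSemialgebraic_soloInformedOpenCube n) 0)
  simpa using h

/-- **Points of a finite `ℚ`-semialgebraic set have algebraic coordinates**: project to one
coordinate (a `ℚ`-semialgebraic image, Tarski–Seidenberg) and use that points of finite
`ℚ`-semialgebraic subsets of the line are algebraic. [folklore; cite: BasuPollackRoy2006, Thm. 2.76] -/
theorem soloInformed_isAlgebraic_apply_of_finite {Z : Set (Fin n → ℝ)} (hZ : IsSemialgebraic ℚ Z)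
    (hfin : Z.Finite) {z : Fin n → ℝ} (hz : z ∈ Z) (i : Fin n) : IsAlgebraic ℚ (z i) := by
  have himg : IsSemialgebraic ℚ ((fun w : Fin n → ℝ => w ∘ (fun _ : Fin 1 => i)) '' Z) :=
    hZ.image_comp (fun _ : Fin 1 => i)
  have hmem : (z ∘ fun _ : Fin 1 => i) ∈ (fun w : Fin n → ℝ => w ∘ (fun _ : Fin 1 => i)) '' Z :=
    mem_image_of_mem _ hz
  exact isAlgebraic_of_mem_of_finite himg (hfin.image _) hmem

/-- Over a real-root-closed field `K ⊆ ℝ`, every real algebraic number is in the image of `K`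
(its minimal polynomial over `ℚ` has coefficients in `K ⊇ ℚ`). [this work] -/
theorem soloInformed_exists_algebraMap_eq_of_isAlgebraic (hKrc : SoloInformedRealRootClosed K)
    {t : ℝ} (ht : IsAlgebraic ℚ t) : ∃ c : K, algebraMap K ℝ c = t := by
  haveI : CharZero K := soloInformed_charZero_of_embedding K
  obtain ⟨p, hp, hpt⟩ := ht
  refine hKrc (p.map (algebraMap ℚ K)) ?_ t ?_
  · exact (Polynomial.map_ne_zero_iff (algebraMap ℚ K).injective).2 hp
  · rw [Polynomial.aeval_map_algebraMap]
    exact hpt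

/-! ## Zeros of the rescaled halves -/

/-- **Zeros of a rescaled polynomial.**  If every zero of `Q` in the open slab
`{α < x_i < α + β} ∩ (0,1)ⁿ` (`α = a`, `β = b` in `ℝ`, `0 ≤ α`, `0 < β`, `α + β ≤ 1`) lies in the
finite set `Z`, then the zero set of `Q ∘ Λ_{i,a,b}` in the open cube is finite with at most
`#Z` points (`Λ_{i,a,b}` maps the open cube injectively into the slab). [this work] -/
theorem soloInformed_zeroSet_scaleSubstK (i : Fin n) {a b : K}
    (ha : 0 ≤ algebraMap K ℝ a) (hb : 0 < algebraMap K ℝ b)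
    (hab : algebraMap K ℝ a + algebraMap K ℝ b ≤ 1) (Q : MvPolynomial (Fin n) K)
    {Z : Set (Fin n → ℝ)} (hZfin : Z.Finite)
    (hZ : ∀ x ∈ soloInformedOpenCube n, algebraMap K ℝ a < x i →
      x i < algebraMap K ℝ a + algebraMap K ℝ b → (MvPolynomial.aeval x Q : ℝ) = 0 → x ∈ Z) :
    {x | x ∈ soloInformedOpenCube n ∧
        (MvPolynomial.aeval x (soloInformedScaleSubstK i a b Q) : ℝ) = 0}.Finite ∧
      {x | x ∈ soloInformedOpenCube n ∧
        (MvPolynomial.aeval x (soloInformedScaleSubstK i a b Q) : ℝ) = 0}.ncard ≤ Z.ncard := by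
  set Λ := soloInformedScaleMoveR i (algebraMap K ℝ a) (algebraMap K ℝ b) with hΛ
  have hmaps : ∀ x ∈ {x | x ∈ soloInformedOpenCube n ∧
      (MvPolynomial.aeval x (soloInformedScaleSubstK i a b Q) : ℝ) = 0}, Λ x ∈ Z := by
    rintro x ⟨hx, hQx⟩
    rw [soloInformed_aeval_scaleSubstK] at hQx
    have hm := soloInformed_scaleMoveR_mem i ha hb hab hx
    exact hZ _ hm.1 hm.2.1 hm.2.2 hQx
  have hinj : InjOn Λ {x | x ∈ soloInformedOpenCube n ∧
      (MvPolynomial.aeval x (soloInformedScaleSubstK i a b Q) : ℝ) = 0} :=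
    (soloInformed_scaleMoveR_injective i hb.ne').injOn
  refine ⟨?_, Set.ncard_le_ncard_of_injOn Λ hmaps hinj hZfin⟩
  exact (hZfin.subset (image_subset_iff.2 hmaps)).of_finite_image hinj

/-! ## THEOREM FIN -/

/-- THEOREM FIN, counted form: induction on the number of zeros in the open square. [this work] -/
theorem soloInformed_presentableDenK_of_finite_zeros_aux
    (hK : ∀ c : K, IsAlgebraic ℚ (algebraMap K ℝ c)) (hKrc : SoloInformedRealRootClosed K) :
    ∀ (N : ℕ) (Q : MvPolynomial (Fin 2) K),
      {x | x ∈ soloInformedOpenCube 2 ∧ (MvPolynomial.aeval x Q : ℝ) = 0}.Finite →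
      {x | x ∈ soloInformedOpenCube 2 ∧ (MvPolynomial.aeval x Q : ℝ) = 0}.ncard ≤ N →
      SoloInformedPresentableDenK Q := by
  have hempty : ∀ Q : MvPolynomial (Fin 2) K,
      {x | x ∈ soloInformedOpenCube 2 ∧ (MvPolynomial.aeval x Q : ℝ) = 0} = ∅ →
      SoloInformedPresentableDenK Q := fun Q hZ =>
    soloInformed_presentableDenK_dim2 hK hKrc Q fun x hx hQx => by
      have hmem : x ∈ {x | x ∈ soloInformedOpenCube 2 ∧ (MvPolynomial.aeval x Q : ℝ) = 0} :=
        ⟨hx, hQx⟩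
      rw [hZ] at hmem
      exact hmem
  intro N
  induction N with
  | zero =>
    intro Q hfin hcard
    exact hempty Q ((Set.ncard_eq_zero hfin).1 (Nat.le_zero.1 hcard))
  | succ N ih =>
    intro Q hfin hcard
    rcases eq_empty_or_nonempty
      {x | x ∈ soloInformedOpenCube 2 ∧ (MvPolynomial.aeval x Q : ℝ) = 0} with hZ | ⟨z, hzO, hzQ⟩
    · exact hempty Q hZ
    -- the abscissa of the zero `z` lies in `K`
    have halg : IsAlgebraic ℚ (z 0) :=
      soloInformed_isAlgebraic_apply_of_finite (soloInformed_isSemialgebraic_zeroSetK hK Q) hfin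
        ⟨hzO, hzQ⟩ 0
    obtain ⟨c, hc⟩ := soloInformed_exists_algebraMap_eq_of_isAlgebraic hKrc halg
    have hc0 : 0 < algebraMap K ℝ c := by rw [hc]; exact (hzO 0).1
    have hc1 : algebraMap K ℝ c < 1 := by rw [hc]; exact (hzO 0).2
    -- the zeros off the cut line
    set Z' : Set (Fin 2 → ℝ) :=
      {x | x ∈ soloInformedOpenCube 2 ∧ (MvPolynomial.aeval x Q : ℝ) = 0} \ {z} with hZ'
    have hZ'fin : Z'.Finite := hfin.sdiff
    have hZ'card : Z'.ncard ≤ N := by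
      have h : Z'.ncard <
          {x | x ∈ soloInformedOpenCube 2 ∧ (MvPolynomial.aeval x Q : ℝ) = 0}.ncard :=
        Set.ncard_sdiff_singleton_lt_of_mem
          (show z ∈ {x | x ∈ soloInformedOpenCube 2 ∧ (MvPolynomial.aeval x Q : ℝ) = 0} from
            ⟨hzO, hzQ⟩) hfin
      omega
    have h0 : algebraMap K ℝ (0 : K) = 0 := map_zero _
    have h1c : algebraMap K ℝ (1 - c) = 1 - algebraMap K ℝ c := by rw [map_sub, map_one]
    -- lower half `x₀ ↦ c·x₀`
    have H₁ := soloInformed_zeroSet_scaleSubstK (0 : Fin 2) (a := 0) (b := c) (by rw [h0]) hc0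
      (by rw [h0, zero_add]; exact hc1.le) Q hZ'fin fun x hx _ hlt hQx => by
        refine ⟨⟨hx, hQx⟩, fun hxz => ?_⟩
        rw [mem_singleton_iff] at hxz
        rw [hxz, h0, zero_add, hc] at hlt
        exact lt_irrefl _ hlt
    -- upper half `x₀ ↦ c + (1 − c)·x₀`
    have H₂ := soloInformed_zeroSet_scaleSubstK (0 : Fin 2) (a := c) (b := 1 - c) hc0.le
      (by rw [h1c]; linarith) (by rw [h1c]; linarith) Q hZ'fin fun x hx hgt _ hQx => by
        refine ⟨⟨hx, hQx⟩, fun hxz => ?_⟩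
        rw [mem_singleton_iff] at hxz
        rw [hxz, hc] at hgt
        exact lt_irrefl _ hgt
    exact soloInformed_presentableDenK_of_split₀ hK 0 c hc0 hc1
      (ih _ H₁.1 (H₁.2.trans hZ'card)) (ih _ H₂.1 (H₂.2.trans hZ'card))

/-- **THEOREM FIN.**  Over a real-root-closed field `K ⊆ ℝ` of real algebraic numbers, every
`Q ∈ K[x₀, x₁]` with finitely many zeros on the open square `(0,1)²` is a presentable denominator.
[this work] -/
theorem soloInformed_presentableDenK_of_finite_zeros
    (hK : ∀ c : K, IsAlgebraic ℚ (algebraMap K ℝ c)) (hKrc : SoloInformedRealRootClosed K)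
    (Q : MvPolynomial (Fin 2) K)
    (hfin : {x | x ∈ soloInformedOpenCube 2 ∧ (MvPolynomial.aeval x Q : ℝ) = 0}.Finite) :
    SoloInformedPresentableDenK Q :=
  soloInformed_presentableDenK_of_finite_zeros_aux hK hKrc _ Q hfin le_rfl

/-- **THEOREM FIN over the real algebraic numbers.** [this work] -/
theorem soloInformed_presentableDenK_of_finite_zeros_algebraicClosure
    (Q : MvPolynomial (Fin 2) (algebraicClosure ℚ ℝ))
    (hfin : {x | x ∈ soloInformedOpenCube 2 ∧ (MvPolynomial.aeval x Q : ℝ) = 0}.Finite) :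
    SoloInformedPresentableDenK Q :=
  soloInformed_presentableDenK_of_finite_zeros soloInformed_algCoeff_algebraicClosure
    soloInformed_realRootClosed_algebraicClosure Q hfin

end Summit.KontsevichZagierPeriods.KontsevichZagierPeriods.Theorems
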